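import Literature.MathematicalPhysics.QuantumFieldTheory.Balaban1983to89.T4NestedCovarianceFibre

/-!
# Bałaban 1983–89, node O3.E-i′ (α), the A-FIELD half: the simultaneous gauge transformation
# `U ↦ U^u, A ↦ R(u)A` (adjoint representation) — covariant background-dependent operator families,
# jointly invariant Gaussian weights and Lie-algebra cut-offs, the adjoint action on the fluctuation-field
# fibres, and the hand-off to `T4FlatExteriorInvariance` / `T4NestedCovariance(Fibre)`

(cell `pub-balaban`, self-proposed row T4-O3.E-i′-Oα-Ad*; GAPS G-pv04g6-1 (A-field ingredients of law (I)) and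
G-pv06g7-2 (conjugation covariance of the background-dependent Gaussian operators of (2.21)); kernel bookkeeping +
cross-read.)

HONEST FRAMING.  The cell's T4 target is the existence and uniqueness of the continuum limit of Bałaban's unit-scale
averaged loop expectations on a finite torus ([Balaban1989LargeFieldII] Thm 1 p. 355 is ultraviolet STABILITY only);
it is NOT the Yang–Mills mass gap and NOT the Clay problem.  This module proves NO estimate and NO statement of the
papers.  It TYPES the one symmetry sentence the A-field (fluctuation-field) factors of the renormalized densities
carry in print — invariance under the SIMULTANEOUS transformation of the background and of the Lie-algebra-valued
field by the adjoint representation — and proves the elementary closure / transport facts that make it usable by the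
sibling leaves: `T4FlatExteriorInvariance` (one-level invariance of the bond-variable fibre law under the CONSTANT
conjugation `conjFun g`, which needs `ConjInvariant old` for the A-integrated factors `old`) and
`T4NestedCovariance` / `T4NestedCovarianceFibre` (node certificates `Invariant`, `InvariantFibre`,
`EquivariantInsertion`, `Form.Adapted` for the joint rotation `jrot`).  The operators of the papers are NOT
constructed here (see NOT CLAIMED).

WHAT IS PRINTED (renders `b2b-balaban-ref1/pages/<stem>/…-pNNN-x2.png` read AS IMAGES by the author seat; journal
page = printed page, PDF page in brackets).

* (P1) [Balaban1988Convergent] (= B14, CMP 119:243) p. 250 [8], after (1.16): «Another important remark is connected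
  with gauge invariance. As in all previous papers the expressions in (1.14)–(1.16), except the characteristic function
  χ′₀(Ω₁), are invariant with respect to the simultaneous gauge transformations
  U₁ → U₁^u, U₁^u(x,x′) = u(x)U₁(x,x′)u^{−1}(x′), A → R(u)A, (R(u)A)(x,x′) = R(u(x))A(x,x′) = u(x)A(x,x′)u^{−1}(x), (1.17)
  where u is a G-valued function defined on sites of the lattice T.» … «In the future we will use both invariance
  properties: the invariance of all the expressions determining the density with respect to the gauge transformations
  of the new field, and the invariance of the effective action with respect to the gauge transformations (1.17). To get
  this invariance for the last integral in (1.16) we have to replace the characteristic function χ′₀(Ω₁) by functions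
  depending on A only.», followed by the decomposition of unity (1.18) in the functions
  «χ({sup_{b∈(□′^{~2})*}|A(b)| < g₀^{−1}δ₀})», «χ({sup_{b∈(□′^{~2})*}|A(b)| ≥ g₀^{−1}δ₀})» and the product (1.19)
  «χ({sup_{b∈(□′^{~2})*}|A(b)| < g₀^{−1}δ₀}) · χ({sup_{b∈(□′^{~2})*}|exp ig₀A(b)U₁(b)U^{−1}_{1,□′}(b) − 1| < 2δ₀})».
* (P2) ibid. p. 249 [7]: «Also, let us recall that the functions and operators on the right-hand side of (1.14) depend
  on the configuration U₁.»; the map C is DEFINED there: «The equation determines the variable A′(b₀(c)) as a linear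
  function of the remaining variables A′(b), b⊂B(c₋)∪B(c₊), b ≠ b₀(c). We denote this function by C, … Hence A′ = CA
  are solutions of the above equations and we have Q̃CA = 0.»; (1.15) carries the factor
  «exp[−½⟨A, C*Δ₁CA⟩ + v(g₀CA) − (1/g₀²)V(g₀CA)]» and (1.16) reads «⟨A, Δ₁A⟩ = ⟨A, ΔA⟩ − 2⟨hC^{(2)}(A), J₁⟩ + 𝐆^{(2)}(A),».
* (P3) ibid. p. 253 [11], (1.26): «∫dA|_{Λ₁}χ^{(0)}(Λ₁)exp[−½⟨Λ₁A, C*Δ₁CΛ₁A⟩ − ⟨Λ₁^cA, C*Δ₁CΛ₁A⟩ + v(g₀CA) −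
  (1/g₀²)V(g₀CA)] = Z^{(0)}(Λ₁)∫dμ_{C^{(0)}(Λ₁)}(A)χ^{(0)}(Λ₁)exp[−⟨Λ₁^cA, C*Δ₁CΛ₁A⟩ + 𝐕^{(0)}(g₀, A)]
  = exp[log Z^{(0)}(Λ₁) + ½⟨Λ₁^cA, C*Δ₁CC^{(0)}(Λ₁)C*Δ₁CΛ₁^cA⟩ + 𝐄^{(1)}(Λ₁, g₀, Λ₁^cA)]. (1.26) The above
  equalities define the functions 𝐕^{(0)} and 𝐄^{(1)}. Let us recall that all the above expressions depend on the
  configuration U₁.»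
* (P4) ibid. p. 257 [15]: «At first we describe in general the operation 𝐓_k. It was described in detail in the first
  step, and the complete inductive definition will follow from constructions of the subsequent sections.»; p. 258 [16],
  (2.21), second factor: «∫dA_j|_{Z_{j+1}∩Ω_{j+1}∩X}χ(Z_{j+1}∩Ω_{j+1}∩X)exp[−½⟨A_j, C*Δ^{(j)}CA_j⟩ +
  ½⟨A_j, C*Δ^{(j)}CC^{(j)}(Λ_{j+1})C*Δ^{(j)}CA_j⟩]» (display certified earlier by other seats, GAPS C-pv06g7-1; re-read).
* (P5) [Balaban1985BackgroundPropagators] (= B9, CMP 99:389) p. 390 [2]: «Let us recall that R(U)X = UXU^{−1}.» …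
  «Let us introduce covariant derivatives. For a matrix valued function A defined at points of the lattice we put
  (D^η_{U₀}A)(b) = η^{−1}(R(U₀(b))A(b₊) − A(b₋)),» [p. 391] «or (D^η_{U₀,μ}A)(x) = (D^η_{U₀}A)(x, x + ηe_μ),
  μ = 1,…,d. (3.3)»; p. 395 [7]: «if we make the transformations U → U^u, U′ → R(u)U′, (3.28) where
  U^u(x,x′) = u(x)U(x,x′)u^{−1}(x′), (R(u)U′)(x,x′) = R(u(x))U′(x,x′), then A^η(R(u)U′U^u) = A^η((U′U)^u) = A^η(U′U).
  (3.29) Of course R(u(x))exp iηA(x,x′) = exp iηR(u(x))A(x,x′) and R(u)A is linear in A, hence …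
  ⟨R(u)A, J^u⟩ = ⟨A, J⟩, ⟨R(u)A, Δ^η(U^u)R(u)A⟩ = ⟨A, Δ^η(U)A⟩, (3.30) or J^u = R(u)J, Δ^η(U^u) = R(u)Δ^η(U)R(u^{−1}).»
  «For the covariant Laplace operator (3.23) we have ⟨R(u)λ, Δ^η_{U^u}R(u)λ⟩ = ⟨λ, Δ^η_Uλ⟩, hence
  Δ^η_{U^u} = R(u)Δ^η_UR(u^{−1}). (3.31)»; p. 396 [8], (3.34): «Δ_a(U^u) = R(u)Δ_a(U)R(u^{−1}),
  G(U^u) = R(u)G(U)R(u^{−1}).»  (The intertwining ALGEBRA (3.30) ⇒ (3.33)/(3.34) is kernel-certified in the sibling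
  leaf `B9Eq333Cov`; it is not re-derived here.)
* (P6) [Balaban1985Averaging] (= B7, CMP 98:17) p. 27 [11], (56)–(57): «where for arbitrary invertible matrix X the
  operator R(X) is given by the formula R(X)Y = XYX^{−1}.» «R(X) acts on the algebra of all matrices and has the
  following properties: R(X)f(Y) = f(R(X)Y) for analytic functions f, R(X)R(Y) = R(XY), R(X)^{−1} = R(X^{−1}),
  R(X)* = R(X*).»
* (P7) [Balaban1989LargeFieldI] (= B15) p. 178 (1.8)/(1.9) (the Lie-algebra cut-offs of χ_{k,Λ}) and p. 182 (1.25) with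
  its gauge-invariance sentence: by POINTER to the cell record `t4/T4-XREAD-O3Ei-alpha.md` §1 L2/L3 (renders certified
  there, GAPS C-pv04g6-1); not re-quoted.

READING (labelled as such, not printed in these words).  (R1) The gauge function u of (1.17)/(3.28) is an ARBITRARY
G-valued site function; the CONSTANT function u ≡ g lies in the printed class and is the joint global colour rotation
(U, A) ↦ (gUg⁻¹, Ad(g)A) used by the sibling leaves (`conjFun`, `conjFun_eq_gaugeAct`, `jrot`).  (R2) For j ≥ 1 the
operators Δ^{(j)}, C, C^{(j)}(Λ_{j+1}) of (2.21) are identified with the first-step objects of (P2)/(P3) only through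
the sentence (P4).  (R3) «R(u)» on the Lie algebra is modelled by an abstract family `Ad : G → (V ≃ₗᵢ[ℝ] V)` of linear
isometries of a real inner-product space `V` (the intended instance, uYu⁻¹ on 𝔤 with an Ad-invariant inner product,
is not constructed).

WHAT THE KERNEL PROVES (every declaration [folklore] unless its docstring carries a [cite:] LOCATOR of the printed
display whose SHAPE it types — a [cite:] here never asserts a result of the paper).
* §1 (abstract, any types): the simultaneous transformation `prodAct ρ σ` (P1)/(3.28); COVARIANT operator families
  `OpCovariant ρ σ τ T : T (ρ g ω) (σ g a) = τ g (T ω a)` (the intertwining form of (3.30)–(3.34)), closed under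
  composition, sums, invariant scalar multiples, two-sided INVERSES (the shape of C^{(0)}(Λ), G(U) = (Δ_a⌈)^{−1}) and
  ADJOINTS with respect to invariant separating pairings (the shape of C*); pairings / quadratic forms of covariant
  families are jointly invariant (the sentence (P1) for ⟨A, C*Δ₁CA⟩, (1.16), and (3.30)/(3.31) read right to left),
  hence so are the Gaussian weights of the printed shapes (1.15)/(1.25)/(2.21) and characteristic functions of
  invariant conditions; integrating a fibre variable against an invariant measure preserves invariance
  (`invariant_marginal`) and equivariance (`equivariant_marginal`) in the background — NO integrability hypotheses.
* §2 (lattice): `adFamily` / `adGauge` / `adAct` = A ↦ R(u)A for coordinate-dependent, site-dependent and constant u;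
  invariance of the pairing Σ⟨A(i), B(i)⟩ and its separation property; the sup cut-offs of (1.18)/(B15 (1.9)) are
  invariant; the mixed cut-off (1.19) is jointly invariant GIVEN the exp-equivariance of (P5) «Of course …» as a
  hypothesis; restriction to a region ((1.26) Λ₁A, Λ₁ᶜA) commutes; and the ONE operator whose covariance is
  DISCHARGED rather than assumed: the covariant derivative (3.3) `covDeriv` is `OpCovariant` for the joint rotation
  given the printed homomorphism properties (P6) of R (`covDeriv_conjFun`).
* §3 (measure): the product Lebesgue measure on `ι → V` is invariant under every coordinatewise family of linear
  isometries (`pi_volume_map_adFamily`; site-dependent R(u) included), an `InvariantFibre` for the constant adjoint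
  action (`invariantFibre_adAct`), also with any invariant density (`pi_volume_withDensity_map_adAct`); hence the
  hand-off `conjInvariant_marginal`: a jointly invariant weight w(U, A) integrates (dA) to a `ConjInvariant` function
  of U — the hypothesis `hold` of `T4FlatExteriorInvariance.fibreLaw_map_conjFun` for A-integrated factors such as
  log Z^{(0)}(Λ₁)(U₁) of (1.26).
* §4 (forms, one universe): on the joint one-scale configuration type `JCfg P j G V = GaugeField P j G × VecField P j V`
  with the joint rotation `jointRot Ad = prodAct jrot (adAct Ad)`, the A-fibre node (Lebesgue on the A-variables of a
  bond set, inserted by `insA`) and the V-fibre node (product Haar, `insV`) of the printed product (2.21)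
  «∫dV_j … · ∫dA_j …» are `Form.Adapted`; so the (2.21)-shaped A-integration with a jointly invariant weight is a
  COVARIANT operation (`covariant_fluctForm`) and nests with everything in `T4NestedCovariance`.

NOT CLAIMED / NOT DONE.  (i) No operator of the papers is constructed: Δ₁, Δ^{(j)}, C, C^{(j)}(Λ), h, C^{(2)}, J₁,
𝐆^{(2)} enter consumers as abstract families whose covariance is a HYPOTHESIS `OpCovariant …`, warranted in print by
(P1)/(P5) at the first step and by the reading (R2) beyond; only D_U is discharged.  (ii) `Ad` is abstract (R3); its
homomorphism properties (P6) and the exp-equivariance (P5) are hypotheses where used.  (iii) Non-constant u is typed in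
§2/§3, but all joint-rotation consumers are constant-u (R1).  (iv) No estimate, positivity, invertibility or
convergence of anything; the variational problems / minimisers / gauge-fixing maps (O-α4 (ii); GAPS G-pv04g6-3,
G-pv01-33) are untouched.  (v) The bond-variable (V) side of (1.25) is the sibling leaf `T4FlatExteriorInvariance`;
multi-scale nesting is `T4NestedCovariance(Fibre)`.  Value = typed skeleton + kernel bookkeeping + cross-read, NOT
summit progress.
-/

open MeasureTheory Function
open scoped BigOperators ENNReal

namespace Literature.MathematicalPhysics.QuantumFieldTheory.Balaban1983to89.T4AdjointCovariance

open T4NestedCovariance T4NestedCovarianceFibre GaugeField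
open T4FlatExteriorInvariance hiding conjEquiv coe_conjEquiv

/-! ## §1  The simultaneous transformation (abstract): covariant operator families, invariant weights, marginals -/

section Abstract

variable {G : Type*} {Ω : Type*} {E : Type*} {F : Type*} {H : Type*}

/-- THE SIMULTANEOUS TRANSFORMATION of a background `ω` (by `ρ g`) and a fluctuation field `a` (by `σ g`):
«U₁ → U₁^u, … A → R(u)A» (1.17), «U → U^u, U′ → R(u)U′» (3.28), as a family of maps of the product space.
[cite: Balaban1988Convergent, (1.17) p.250] -/
def prodAct (ρ : G → Ω → Ω) (σ : G → E → E) : G → Ω × E → Ω × E := fun g p => (ρ g p.1, σ g p.2)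

/-- `prodAct` on components. [folklore] -/
@[simp] theorem prodAct_apply (ρ : G → Ω → Ω) (σ : G → E → E) (g : G) (p : Ω × E) :
    prodAct ρ σ g p = (ρ g p.1, σ g p.2) := rfl

/-- A COVARIANT BACKGROUND-DEPENDENT OPERATOR FAMILY `ω ↦ T ω : E → F`: transforming background and argument
simultaneously transforms the value, `T (ρ g ω) (σ g a) = τ g (T ω a)` — the intertwining form
«Δ^η(U^u) = R(u)Δ^η(U)R(u^{−1})» of (3.30)–(3.34), allowing different actions on source and target.  For the
operators of the papers this is a HYPOTHESIS of the consumers, never discharged here except for `covDeriv`.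
[cite: Balaban1985BackgroundPropagators, (3.30) p.395] -/
def OpCovariant (ρ : G → Ω → Ω) (σ : G → E → E) (τ : G → F → F) (T : Ω → E → F) : Prop :=
  ∀ g ω a, T (ρ g ω) (σ g a) = τ g (T ω a)

/-- `OpCovariant` is `T4NestedCovariance.Equivariant` of the uncurried family for the simultaneous transformation.
[folklore] -/
theorem opCovariant_iff_equivariant (ρ : G → Ω → Ω) (σ : G → E → E) (τ : G → F → F) (T : Ω → E → F) :
    OpCovariant ρ σ τ T ↔ Equivariant (prodAct ρ σ) τ (fun p => T p.1 p.2) :=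
  ⟨fun h g p => h g p.1 p.2, fun h g ω a => h g (ω, a)⟩

namespace OpCovariant

variable {ρ : G → Ω → Ω} {σ : G → E → E} {τ : G → F → F} {υ : G → H → H}

/-- The argument map `a ↦ a` is covariant. [folklore] -/
protected theorem id : OpCovariant ρ σ σ (fun _ a => a) := fun _ _ _ => rfl

/-- A background-INDEPENDENT map commuting with the actions is covariant (lattice differences, restrictions to a
region, fixed averaging operators on Lie-algebra fields). [folklore] -/
theorem of_const {L : E → F} (hL : ∀ g a, L (σ g a) = τ g (L a)) : OpCovariant ρ σ τ (fun _ => L) :=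
  fun g _ a => hL g a

/-- COMPOSITION of covariant families is covariant (C*Δ₁C, CC^{(0)}(Λ)C*Δ₁C, …). [folklore] -/
theorem comp {T₁ : Ω → F → H} {T₂ : Ω → E → F} (h₁ : OpCovariant ρ τ υ T₁) (h₂ : OpCovariant ρ σ τ T₂) :
    OpCovariant ρ σ υ (fun ω a => T₁ ω (T₂ ω a)) := fun g ω a => by
  show T₁ (ρ g ω) (T₂ (ρ g ω) (σ g a)) = υ g (T₁ ω (T₂ ω a))
  rw [h₂ g ω a, h₁ g ω]

/-- SUM of covariant families (for an additive target action), as in (1.16)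
«⟨A, Δ₁A⟩ = ⟨A, ΔA⟩ − 2⟨hC^{(2)}(A), J₁⟩ + 𝐆^{(2)}(A)». [folklore] -/
theorem add [Add F] (hτ : ∀ g (x y : F), τ g (x + y) = τ g x + τ g y) {T₁ T₂ : Ω → E → F}
    (h₁ : OpCovariant ρ σ τ T₁) (h₂ : OpCovariant ρ σ τ T₂) :
    OpCovariant ρ σ τ (fun ω a => T₁ ω a + T₂ ω a) := fun g ω a => by
  show T₁ (ρ g ω) (σ g a) + T₂ (ρ g ω) (σ g a) = τ g (T₁ ω a + T₂ ω a)
  rw [h₁ g ω a, h₂ g ω a, hτ]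

/-- DIFFERENCE of covariant families. [folklore] -/
theorem sub [Sub F] (hτ : ∀ g (x y : F), τ g (x - y) = τ g x - τ g y) {T₁ T₂ : Ω → E → F}
    (h₁ : OpCovariant ρ σ τ T₁) (h₂ : OpCovariant ρ σ τ T₂) :
    OpCovariant ρ σ τ (fun ω a => T₁ ω a - T₂ ω a) := fun g ω a => by
  show T₁ (ρ g ω) (σ g a) - T₂ (ρ g ω) (σ g a) = τ g (T₁ ω a - T₂ ω a)
  rw [h₁ g ω a, h₂ g ω a, hτ]

/-- INVARIANT SCALAR MULTIPLE of a covariant family (coupling constants, invariant background functionals).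
[folklore] -/
theorem smul {𝕜 : Type*} [SMul 𝕜 F] (hτ : ∀ g (c : 𝕜) (x : F), τ g (c • x) = c • τ g x) {c : Ω → 𝕜}
    (hc : Invariant ρ c) {T : Ω → E → F} (h : OpCovariant ρ σ τ T) :
    OpCovariant ρ σ τ (fun ω a => c ω • T ω a) := fun g ω a => by
  show c (ρ g ω) • T (ρ g ω) (σ g a) = τ g (c ω • T ω a)
  rw [hc g ω, h g ω a, hτ]

/-- FINITE SUM of covariant families. [folklore] -/
theorem sum [AddCommMonoid F] {ι : Type*} (h0 : ∀ g, τ g 0 = 0)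
    (hτ : ∀ g (x y : F), τ g (x + y) = τ g x + τ g y) {T : ι → Ω → E → F}
    (h : ∀ i, OpCovariant ρ σ τ (T i)) (s : Finset ι) :
    OpCovariant ρ σ τ (fun ω a => ∑ i ∈ s, T i ω a) := by
  classical
  intro g ω a
  show ∑ i ∈ s, T i (ρ g ω) (σ g a) = τ g (∑ i ∈ s, T i ω a)
  induction s using Finset.induction_on with
  | empty => simp [h0]
  | @insert i s hi ih => rw [Finset.sum_insert hi, Finset.sum_insert hi, hτ, ih, h i g ω a]

/-- TWO-SIDED INVERSE of a covariant family is covariant (with the actions exchanged): the shape of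
«G(U^u) = R(u)G(U)R(u^{−1})» (3.34) for G(U) = (Δ_a⌈_{Ω₀})^{−1}, and of the conditional covariance C^{(0)}(Λ₁) of
(1.26) as the inverse of the Λ₁-restricted quadratic-form operator (on the space of Λ₁-supported fields).  Compare
`B9Eq333Cov.inverse_intertwine` (same algebra, linear-map typing). [cite: Balaban1985BackgroundPropagators, (3.34) p.396] -/
theorem inverse {T : Ω → E → F} {S : Ω → F → E} (hT : OpCovariant ρ σ τ T)
    (h₁ : ∀ ω f, T ω (S ω f) = f) (h₂ : ∀ ω a, S ω (T ω a) = a) : OpCovariant ρ τ σ S := fun g ω f => by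
  have h := h₂ (ρ g ω) (σ g (S ω f))
  rw [hT g ω, h₁] at h
  exact h

/-- ADJOINT of a covariant family with respect to INVARIANT pairings is covariant (with the actions exchanged), when
the source action is onto and the source pairing separates points: the shape of C* in «C*Δ₁C» (1.15)/(2.21) and of
«R(X)* = R(X*)» (57).  Compare `B9Eq333Cov.adj_intertwine` (inner-product typing). [folklore] -/
theorem adjoint {R : Type*} {BE : E → E → R} {BF : F → F → R} {T : Ω → E → F} {Ts : Ω → F → E}
    (hadj : ∀ ω a f, BF (T ω a) f = BE a (Ts ω f))
    (hBE : ∀ g x y, BE (σ g x) (σ g y) = BE x y) (hBF : ∀ g x y, BF (τ g x) (τ g y) = BF x y)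
    (hσ : ∀ g, Function.Surjective (σ g)) (hsep : ∀ x x' : E, (∀ y, BE y x = BE y x') → x = x')
    (hT : OpCovariant ρ σ τ T) : OpCovariant ρ τ σ Ts := fun g ω f => by
  apply hsep
  intro y
  obtain ⟨x, rfl⟩ := hσ g y
  rw [hBE, ← hadj, ← hadj, hT g ω x, hBF]

end OpCovariant

variable {ρ : G → Ω → Ω} {σ : G → E → E} {τ : G → F → F}

/-- A background-only invariant weight is jointly invariant. [folklore] -/
theorem invariant_fst {α : Type*} {φ : Ω → α} (h : Invariant ρ φ) : Invariant (prodAct ρ σ) (fun p => φ p.1) :=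
  fun g p => h g p.1

/-- An A-only weight invariant under the adjoint action is jointly invariant — the printed remedy «we have to replace
the characteristic function χ′₀(Ω₁) by functions depending on A only» (the cut-offs (1.18)).
[cite: Balaban1988Convergent, (1.18) p.250] -/
theorem invariant_snd {α : Type*} {χ : E → α} (h : ∀ g a, χ (σ g a) = χ a) :
    Invariant (prodAct ρ σ) (fun p => χ p.2) := fun g p => h g p.2

/-- Post-composition preserves invariance (exp, log, powers, products with constants). [folklore] -/
theorem invariant_postcomp {X α β : Type*} {ρX : G → X → X} {w : X → α} (h : Invariant ρX w) (φ : α → β) :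
    Invariant ρX (fun x => φ (w x)) := fun g x => by
  show φ (w (ρX g x)) = φ (w x)
  rw [h g x]

/-- PAIRING OF TWO COVARIANT FAMILIES under an invariant pairing is jointly invariant:
(ω, a) ↦ B (S ω a) (T ω a) — e.g. ⟨A, C*Δ₁CA⟩ = ⟨CA, Δ₁(CA)⟩ with S = C, T = Δ₁C, or the cross term
«⟨Λ₁^cA, C*Δ₁CΛ₁A⟩» of (1.26). [cite: Balaban1988Convergent, (1.17) p.250] -/
theorem invariant_pairing {R : Type*} {B : F → F → R} (hB : ∀ g x y, B (τ g x) (τ g y) = B x y)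
    {S T : Ω → E → F} (hS : OpCovariant ρ σ τ S) (hT : OpCovariant ρ σ τ T) :
    Invariant (prodAct ρ σ) (fun p => B (S p.1 p.2) (T p.1 p.2)) := fun g p => by
  show B (S (ρ g p.1) (σ g p.2)) (T (ρ g p.1) (σ g p.2)) = B (S p.1 p.2) (T p.1 p.2)
  rw [hS g p.1 p.2, hT g p.1 p.2, hB]

/-- QUADRATIC FORM of a covariant family under an invariant pairing is jointly invariant:
«⟨R(u)A, Δ^η(U^u)R(u)A⟩ = ⟨A, Δ^η(U)A⟩» (3.30), «⟨R(u)λ, Δ^η_{U^u}R(u)λ⟩ = ⟨λ, Δ^η_Uλ⟩» (3.31), read from the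
covariance (right to left). [cite: Balaban1985BackgroundPropagators, (3.30) p.395] -/
theorem invariant_quadForm {R : Type*} {B : E → E → R} (hB : ∀ g x y, B (σ g x) (σ g y) = B x y)
    {T : Ω → E → E} (hT : OpCovariant ρ σ σ T) : Invariant (prodAct ρ σ) (fun p => B p.2 (T p.1 p.2)) :=
  invariant_pairing hB OpCovariant.id hT

/-- THE GAUSSIAN WEIGHT exp[−½⟨A, X(U)A⟩] of a covariant family X under an invariant pairing is jointly invariant —
the factor «exp[−½⟨A, C*Δ₁CA⟩ …]» of (1.15), the Gaussian A_j-weight of B15 (1.25) (pointer (P7)), and the first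
term of (2.21). [cite: Balaban1988Convergent, (1.17) p.250] -/
theorem invariant_gaussWeight {B : E → E → ℝ} (hB : ∀ g x y, B (σ g x) (σ g y) = B x y) {X : Ω → E → E}
    (hX : OpCovariant ρ σ σ X) :
    Invariant (prodAct ρ σ) (fun p => Real.exp (-(1 / 2 : ℝ) * B p.2 (X p.1 p.2))) :=
  invariant_postcomp (invariant_quadForm hB hX) fun t => Real.exp (-(1 / 2 : ℝ) * t)

/-- THE ONE-STEP FLUCTUATION WEIGHT of the printed shape (2.21), exp[−½⟨A_j, XA_j⟩ + ½⟨A_j, XYXA_j⟩] with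
X = C*Δ^{(j)}C and Y = C^{(j)}(Λ_{j+1}) covariant families, is jointly invariant. [cite: Balaban1988Convergent, (2.21) p.258] -/
theorem invariant_oneStepWeight {B : E → E → ℝ} (hB : ∀ g x y, B (σ g x) (σ g y) = B x y) {X Y : Ω → E → E}
    (hX : OpCovariant ρ σ σ X) (hY : OpCovariant ρ σ σ Y) :
    Invariant (prodAct ρ σ) (fun p =>
      Real.exp (-(1 / 2 : ℝ) * B p.2 (X p.1 p.2) + (1 / 2 : ℝ) * B p.2 (X p.1 (Y p.1 (X p.1 p.2))))) :=
  fun g p => by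
    show Real.exp (-(1 / 2 : ℝ) * B (σ g p.2) (X (ρ g p.1) (σ g p.2)) +
        (1 / 2 : ℝ) * B (σ g p.2) (X (ρ g p.1) (Y (ρ g p.1) (X (ρ g p.1) (σ g p.2))))) = _
    rw [hX g p.1 p.2, hY g p.1, hX g p.1, hB, hB]

open Classical in
/-- THE CHARACTERISTIC FUNCTION χ(Q) of a condition `Q`, as a real weight (1 on `Q`, 0 off `Q`). [folklore] -/
noncomputable def charFn {X : Type*} (Q : X → Prop) : X → ℝ := fun x => if Q x then 1 else 0

/-- `charFn Q` takes equal values at points where `Q` is equivalent. [folklore] -/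
theorem charFn_congr {X : Type*} {Q : X → Prop} {x y : X} (h : Q x ↔ Q y) : charFn Q x = charFn Q y := by
  unfold charFn
  by_cases hy : Q y
  · rw [if_pos hy, if_pos (h.mpr hy)]
  · rw [if_neg hy, if_neg (mt h.mp hy)]

/-- `charFn Q` is nonnegative. [folklore] -/
theorem charFn_nonneg {X : Type*} (Q : X → Prop) (x : X) : 0 ≤ charFn Q x := by
  unfold charFn
  by_cases hx : Q x
  · rw [if_pos hx]; exact zero_le_one
  · rw [if_neg hx]

/-- The characteristic function of an INVARIANT CONDITION is an invariant weight (the A-only cut-offs of (1.18),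
and (1.19) under the hypothesis of `mixedSmallOn_joint_iff`). [folklore] -/
theorem invariant_charFn {X : Type*} {ρX : G → X → X} {Q : X → Prop} (hQ : ∀ g x, Q (ρX g x) ↔ Q x) :
    Invariant ρX (charFn Q) := fun g x => charFn_congr (hQ g x)

/-- MARGINALISATION PRESERVES INVARIANCE: integrating the fibre variable of a jointly invariant integrand against
an invariant fibre measure gives an invariant function of the background — no integrability hypothesis (change of
variables along a measurable embedding).  The mechanism behind «the invariance of the effective action with respect
to the gauge transformations (1.17)» surviving the A-integration (1.26) (log Z^{(0)}(Λ₁), 𝐄^{(1)} as functions of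
U₁). [folklore] -/
theorem invariant_marginal {S : Type*} [MeasurableSpace S] {ν : Measure S} {σS : G → S → S}
    (hν : InvariantFibre σS ν) {W : Type*} [NormedAddCommGroup W] [NormedSpace ℝ W] {w : Ω × S → W}
    (hw : Invariant (prodAct ρ σS) w) : Invariant ρ (fun ω => ∫ s, w (ω, s) ∂ν) := fun g ω => by
  have h := (hν g).1.integral_map (μ := ν) (fun s => w (ρ g ω, s))
  rw [(hν g).2] at h
  show ∫ s, w (ρ g ω, s) ∂ν = ∫ s, w (ω, s) ∂ν
  rw [h]
  exact integral_congr_ae (Filter.Eventually.of_forall fun s => hw g (ω, s))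

/-- MARGINALISATION PRESERVES EQUIVARIANCE (values rotated by continuous linear automorphisms; inserts linear in the
fluctuation field, first-order terms): again with no integrability hypothesis
(`ContinuousLinearEquiv.integral_comp_comm`). [folklore] -/
theorem equivariant_marginal {S : Type*} [MeasurableSpace S] {ν : Measure S} {σS : G → S → S}
    (hν : InvariantFibre σS ν) {W : Type*} [NormedAddCommGroup W] [NormedSpace ℝ W] (A : G → W ≃L[ℝ] W)
    {w : Ω × S → W} (hw : Equivariant (prodAct ρ σS) (fun g => A g) w) :
    Equivariant ρ (fun g => A g) (fun ω => ∫ s, w (ω, s) ∂ν) := fun g ω => by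
  have h := (hν g).1.integral_map (μ := ν) (fun s => w (ρ g ω, s))
  rw [(hν g).2] at h
  show ∫ s, w (ρ g ω, s) ∂ν = A g (∫ s, w (ω, s) ∂ν)
  rw [h, ← ContinuousLinearEquiv.integral_comp_comm (A g) (fun s => w (ω, s))]
  exact integral_congr_ae (Filter.Eventually.of_forall fun s => hw g (ω, s))

end Abstract

/-! ## §2  The lattice level: `A ↦ R(u)A` on Lie-algebra-valued fields, cut-offs, restriction, the covariant derivative -/

section Lattice

variable {G : Type*} {ι : Type*} {V : Type*} [NormedAddCommGroup V] [InnerProductSpace ℝ V]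

/-- COORDINATEWISE action of a family of linear isometries: `(R(u)A)(x,x′) = R(u(x))A(x,x′)` with the isometry
attached to each coordinate (bond / site). [cite: Balaban1988Convergent, (1.17) p.250] -/
def adFamily (f : ι → V ≃ₗᵢ[ℝ] V) (A : ι → V) : ι → V := fun i => f i (A i)

/-- `adFamily` on a coordinate. [folklore] -/
@[simp] theorem adFamily_apply (f : ι → V ≃ₗᵢ[ℝ] V) (A : ι → V) (i : ι) : adFamily f A i = f i (A i) := rfl

/-- THE CONSTANT ADJOINT ACTION `A ↦ Ad(g)A` on `V`-valued fields over any index type (constant u ≡ g in (1.17),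
reading (R1)); the fibre action of the sibling leaves' joint rotation on the fluctuation variables. [folklore] -/
def adAct (Ad : G → V ≃ₗᵢ[ℝ] V) (g : G) (A : ι → V) : ι → V := fun i => Ad g (A i)

/-- `adAct` on a coordinate. [folklore] -/
@[simp] theorem adAct_apply (Ad : G → V ≃ₗᵢ[ℝ] V) (g : G) (A : ι → V) (i : ι) : adAct Ad g A i = Ad g (A i) :=
  rfl

/-- `adAct` is `adFamily` of the constant family. [folklore] -/
theorem adAct_eq_adFamily (Ad : G → V ≃ₗᵢ[ℝ] V) (g : G) :
    (adAct Ad g : (ι → V) → ι → V) = adFamily fun _ : ι => Ad g := rfl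

/-- `adFamily` of the inverse isometries undoes `adFamily`. [folklore] -/
theorem adFamily_symm_adFamily (f : ι → V ≃ₗᵢ[ℝ] V) (A : ι → V) :
    adFamily (fun i => (f i).symm) (adFamily f A) = A := by
  funext i; simp

/-- … and conversely. [folklore] -/
theorem adFamily_adFamily_symm (f : ι → V ≃ₗᵢ[ℝ] V) (A : ι → V) :
    adFamily f (adFamily (fun i => (f i).symm) A) = A := by
  funext i; simp

/-- `adFamily f` is onto. [folklore] -/
theorem adFamily_surjective (f : ι → V ≃ₗᵢ[ℝ] V) : Function.Surjective (adFamily f) :=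
  fun A => ⟨adFamily (fun i => (f i).symm) A, adFamily_adFamily_symm f A⟩

/-- `adFamily` preserves the coordinate norms, |R(u(x))A(x,x′)| = |A(x,x′)|. [folklore] -/
theorem norm_adFamily_apply (f : ι → V ≃ₗᵢ[ℝ] V) (A : ι → V) (i : ι) : ‖adFamily f A i‖ = ‖A i‖ :=
  (f i).norm_map (A i)

/-- `adFamily` is additive. [folklore] -/
theorem adFamily_add (f : ι → V ≃ₗᵢ[ℝ] V) (A B : ι → V) : adFamily f (A + B) = adFamily f A + adFamily f B := by
  funext i; simp

/-- `adFamily` is homogeneous. [folklore] -/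
theorem adFamily_smul (f : ι → V ≃ₗᵢ[ℝ] V) (c : ℝ) (A : ι → V) : adFamily f (c • A) = c • adFamily f A := by
  funext i; simp

/-- `adFamily` fixes 0. [folklore] -/
theorem adFamily_zero (f : ι → V ≃ₗᵢ[ℝ] V) : adFamily f (0 : ι → V) = 0 := by
  funext i; simp

/-- `adFamily` commutes with subtraction. [folklore] -/
theorem adFamily_sub (f : ι → V ≃ₗᵢ[ℝ] V) (A B : ι → V) : adFamily f (A - B) = adFamily f A - adFamily f B := by
  funext i; simp

section Pairing

variable [Fintype ι]

/-- THE REAL PAIRING ⟨A, B⟩ = Σ_i ⟨A(i), B(i)⟩ of `V`-valued fields (the L² scalar products of the papers up to the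
constant weights η^d, which change nothing below). [folklore] -/
noncomputable def pairSum (A B : ι → V) : ℝ := ∑ i, inner ℝ (A i) (B i)

/-- THE PAIRING IS INVARIANT under every coordinatewise family of isometries: ⟨R(u)A, R(u)B⟩ = ⟨A, B⟩.
[folklore] -/
theorem pairSum_adFamily (f : ι → V ≃ₗᵢ[ℝ] V) (A B : ι → V) :
    pairSum (adFamily f A) (adFamily f B) = pairSum A B := by
  unfold pairSum
  simp only [adFamily_apply, LinearIsometryEquiv.inner_map_map]

/-- … in particular under the constant adjoint action. [folklore] -/
theorem pairSum_adAct (Ad : G → V ≃ₗᵢ[ℝ] V) (g : G) (A B : ι → V) :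
    pairSum (adAct Ad g A) (adAct Ad g B) = pairSum A B :=
  pairSum_adFamily (fun _ => Ad g) A B

/-- THE PAIRING SEPARATES POINTS (hypothesis `hsep` of `OpCovariant.adjoint`). [folklore] -/
theorem pairSum_separating [DecidableEq ι] (A B : ι → V) (h : ∀ C : ι → V, pairSum C A = pairSum C B) : A = B := by
  funext i
  have key : pairSum (Pi.single i (A i - B i)) A - pairSum (Pi.single i (A i - B i)) B = 0 := by
    rw [h, sub_self]
  unfold pairSum at key
  rw [← Finset.sum_sub_distrib, Finset.sum_eq_single i (fun k _ hk => by
      rw [Pi.single_eq_of_ne hk, inner_zero_left, inner_zero_left, sub_self])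
      (fun hi => absurd (Finset.mem_univ i) hi), Pi.single_eq_same, ← inner_sub_right,
    real_inner_self_eq_norm_sq] at key
  exact sub_eq_zero.mp (norm_eq_zero.mp ((pow_eq_zero_iff two_ne_zero).mp key))

end Pairing

/-- THE SUP CUT-OFF CONDITION sup_{b∈S}|A(b)| < δ of the cut-offs «χ({sup_{b∈(□′^{~2})*}|A(b)| < g₀^{−1}δ₀})»
(1.18) / B15 (1.9), for any size function `nV` on `V` (the papers' |·| on the Lie algebra).
[cite: Balaban1988Convergent, (1.18) p.250] -/
def SupSmallOn (S : Set ι) (nV : V → ℝ) (δ : ℝ) (A : ι → V) : Prop := ∀ i ∈ S, nV (A i) < δ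

/-- The sup cut-off is invariant under every coordinatewise family of maps preserving `nV`. [folklore] -/
theorem supSmallOn_adFamily_iff {S : Set ι} {nV : V → ℝ} {f : ι → V ≃ₗᵢ[ℝ] V} (hn : ∀ i v, nV (f i v) = nV v)
    (δ : ℝ) (A : ι → V) : SupSmallOn S nV δ (adFamily f A) ↔ SupSmallOn S nV δ A := by
  simp only [SupSmallOn, adFamily_apply, hn]

/-- … unconditionally for the norm of `V`. [folklore] -/
theorem supSmallOn_norm_adFamily_iff (S : Set ι) (f : ι → V ≃ₗᵢ[ℝ] V) (δ : ℝ) (A : ι → V) :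
    SupSmallOn S norm δ (adFamily f A) ↔ SupSmallOn S norm δ A :=
  supSmallOn_adFamily_iff (fun i v => (f i).norm_map v) δ A

/-- … and for the constant adjoint action. [folklore] -/
theorem supSmallOn_adAct_iff {S : Set ι} {nV : V → ℝ} {Ad : G → V ≃ₗᵢ[ℝ] V} (hn : ∀ g v, nV (Ad g v) = nV v)
    (δ : ℝ) (g : G) (A : ι → V) : SupSmallOn S nV δ (adAct Ad g A) ↔ SupSmallOn S nV δ A :=
  supSmallOn_adFamily_iff (f := fun _ => Ad g) (fun _ v => hn g v) δ A

/-- RESTRICTION TO A REGION (extension by zero): «Λ₁A», «Λ₁^cA» of (1.26). [cite: Balaban1988Convergent, (1.26) p.253] -/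
def restrictTo (Λ : Set ι) [DecidablePred (· ∈ Λ)] (A : ι → V) : ι → V := fun i => if i ∈ Λ then A i else 0

/-- Restriction commutes with every coordinatewise linear family. [folklore] -/
theorem restrictTo_adFamily (Λ : Set ι) [DecidablePred (· ∈ Λ)] (f : ι → V ≃ₗᵢ[ℝ] V) (A : ι → V) :
    restrictTo Λ (adFamily f A) = adFamily f (restrictTo Λ A) := by
  funext i
  unfold restrictTo
  by_cases h : i ∈ Λ
  · simp only [adFamily_apply, if_pos h]
  · simp only [adFamily_apply, if_neg h, map_zero]

/-- Hence restriction to a region is a covariant (background-independent) family for the constant adjoint action.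
[folklore] -/
theorem opCovariant_restrictTo {Ω : Type*} (ρ : G → Ω → Ω) (Ad : G → V ≃ₗᵢ[ℝ] V) (Λ : Set ι)
    [DecidablePred (· ∈ Λ)] :
    OpCovariant ρ (adAct Ad (ι := ι)) (adAct Ad (ι := ι)) (fun _ => restrictTo Λ) :=
  OpCovariant.of_const fun g A => restrictTo_adFamily Λ (fun _ => Ad g) A

section Gauge

variable {P : Params} {j : ℕ}

/-- THE SITE-DEPENDENT ADJOINT GAUGE TRANSFORMATION of a bond field: «(R(u)A)(x,x′) = R(u(x))A(x,x′)» (1.17) — the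
isometry at a bond is the one of its source site. [cite: Balaban1988Convergent, (1.17) p.250] -/
def adGauge (Ad : G → V ≃ₗᵢ[ℝ] V) (u : GaugeTransf P j G) : VecField P j V → VecField P j V :=
  adFamily fun b => Ad (u b.src)

/-- `adGauge` on a bond. [folklore] -/
@[simp] theorem adGauge_apply (Ad : G → V ≃ₗᵢ[ℝ] V) (u : GaugeTransf P j G) (A : VecField P j V) (b : PBond P j) :
    adGauge Ad u A b = Ad (u b.src) (A b) := rfl

/-- The constant gauge function gives the constant adjoint action (reading (R1); compare
`T4FlatExteriorInvariance.conjFun_eq_gaugeAct`). [folklore] -/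
theorem adGauge_const (Ad : G → V ≃ₗᵢ[ℝ] V) (g : G) :
    adGauge (P := P) (j := j) Ad (fun _ => g) = adAct Ad g := rfl

/-- THE COVARIANT DERIVATIVE «(D^η_{U₀}A)(b) = η^{−1}(R(U₀(b))A(b₊) − A(b₋))» (3.3) of a site field along the
background `U` (the factor η^{−1}, a constant, is dropped). [cite: Balaban1985BackgroundPropagators, (3.3) p.391] -/
def covDeriv (Ad : G → V ≃ₗᵢ[ℝ] V) (U : GaugeField P j G) (lam : SiteField P j V) : VecField P j V :=
  fun b => Ad (U b) (lam b.tgt) - lam b.src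

variable [GaugeGroup G]

/-- THE COVARIANT DERIVATIVE IS A COVARIANT FAMILY for the joint rotation — DISCHARGED from the homomorphism
properties «R(X)R(Y) = R(XY), R(X)^{−1} = R(X^{−1})» (57) of the adjoint representation, here the hypotheses
`hmul`, `hinv`: D_{gUg⁻¹}(Ad(g)λ) = Ad(g)(D_U λ), the constant-u case of (3.31)'s mechanism.
[cite: Balaban1985Averaging, (57) p.27] -/
theorem covDeriv_conjFun {Ad : G → V ≃ₗᵢ[ℝ] V} (hmul : ∀ (g h : G) (v : V), Ad (g * h) v = Ad g (Ad h v))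
    (hinv : ∀ (g : G) (v : V), Ad g⁻¹ (Ad g v) = v) (g : G) (U : GaugeField P j G) (lam : SiteField P j V) :
    covDeriv Ad (conjFun g U) (adAct Ad g lam) = adAct Ad g (covDeriv Ad U lam) := by
  funext b
  simp only [covDeriv, adAct_apply, conjFun_apply, map_sub]
  rw [hmul, hmul, hinv]

/-- … i.e. `covDeriv Ad` is `OpCovariant` from site fields to bond fields for the joint rotation `jrot`. [folklore] -/
theorem opCovariant_covDeriv {Ad : G → V ≃ₗᵢ[ℝ] V} (hmul : ∀ (g h : G) (v : V), Ad (g * h) v = Ad g (Ad h v))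
    (hinv : ∀ (g : G) (v : V), Ad g⁻¹ (Ad g v) = v) :
    OpCovariant (jrot (P := P) (j := j) (G := G)) (adAct Ad (ι := Site P j)) (adAct Ad (ι := PBond P j))
      (covDeriv Ad) :=
  fun g U lam => covDeriv_conjFun hmul hinv g U lam

/-- THE MIXED CUT-OFF CONDITION of (1.19) / B15 (1.8), «sup_{b∈(□′^{~2})*}|exp ig₀A(b)U₁(b)U^{−1}_{1,□′}(b) − 1| < 2δ₀»
on a bond set `S`, with an abstract exponential map `expV : V → G` (absorbing g₀) and a reference field `W` (the block
field U_{1,□′}). [cite: Balaban1988Convergent, (1.19) p.250] -/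
def MixedSmallOn (S : Set (PBond P j)) (δ : ℝ) (expV : V → G) (W U : GaugeField P j G) (A : VecField P j V) :
    Prop :=
  ∀ b ∈ S, dist1 (expV (A b) * U b * (W b)⁻¹) < δ

/-- The mixed cut-off is JOINTLY invariant — background, reference field and A all rotated — GIVEN the equivariance
«R(u(x))exp iηA(x,x′) = exp iηR(u(x))A(x,x′)» of the exponential map as the hypothesis `hexp`
(`GaugeGroup.dist1_conj`). [cite: Balaban1985BackgroundPropagators, (3.29) p.395] -/
theorem mixedSmallOn_joint_iff {Ad : G → V ≃ₗᵢ[ℝ] V} {expV : V → G}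
    (hexp : ∀ (g : G) (v : V), expV (Ad g v) = g * expV v * g⁻¹) (S : Set (PBond P j)) (δ : ℝ) (g : G)
    (W U : GaugeField P j G) (A : VecField P j V) :
    MixedSmallOn S δ expV (conjFun g W) (conjFun g U) (adAct Ad g A) ↔ MixedSmallOn S δ expV W U A := by
  have key : ∀ b : PBond P j,
      dist1 (expV (adAct Ad g A b) * conjFun g U b * (conjFun g W b)⁻¹) = dist1 (expV (A b) * U b * (W b)⁻¹) := by
    intro b
    rw [adAct_apply, conjFun_apply, conjFun_apply, hexp]
    have : g * expV (A b) * g⁻¹ * (g * U b * g⁻¹) * (g * W b * g⁻¹)⁻¹ = g * (expV (A b) * U b * (W b)⁻¹) * g⁻¹ := by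
      group
    rw [this, GaugeGroup.dist1_conj]
  simp only [MixedSmallOn, key]

/-- … and for a reference field FIXED by the rotation (flat block field, or a covariant function of a fixed exterior,
`T4FlatExteriorInvariance.fixed_of_covariant`) the condition is invariant under the joint rotation of (U, A) alone.
[folklore] -/
theorem mixedSmallOn_joint_iff_of_fixed {Ad : G → V ≃ₗᵢ[ℝ] V} {expV : V → G}
    (hexp : ∀ (g : G) (v : V), expV (Ad g v) = g * expV v * g⁻¹) (S : Set (PBond P j)) (δ : ℝ) {g : G}
    {W : GaugeField P j G} (hW : conjFun g W = W) (U : GaugeField P j G) (A : VecField P j V) :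
    MixedSmallOn S δ expV W (conjFun g U) (adAct Ad g A) ↔ MixedSmallOn S δ expV W U A := by
  have h := mixedSmallOn_joint_iff hexp S δ g W U A
  rwa [hW] at h

/-- Hence the (1.19)-type characteristic function is a jointly invariant weight on (U, A) (fixed reference field).
[folklore] -/
theorem invariant_charFn_mixedSmallOn {Ad : G → V ≃ₗᵢ[ℝ] V} {expV : V → G}
    (hexp : ∀ (g : G) (v : V), expV (Ad g v) = g * expV v * g⁻¹) (S : Set (PBond P j)) (δ : ℝ)
    {W : GaugeField P j G} (hW : ∀ g : G, conjFun g W = W) :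
    Invariant (prodAct (jrot (P := P) (j := j) (G := G)) (adAct Ad (ι := PBond P j)))
      (charFn fun p : GaugeField P j G × VecField P j V => MixedSmallOn S δ expV W p.1 p.2) :=
  invariant_charFn fun g p => mixedSmallOn_joint_iff_of_fixed hexp S δ (hW g) p.1 p.2

/-- The (1.18)-type sup cut-off as a jointly invariant weight on (U, A). [folklore] -/
theorem invariant_charFn_supSmallOn {Ad : G → V ≃ₗᵢ[ℝ] V} {nV : V → ℝ} (hn : ∀ g v, nV (Ad g v) = nV v)
    (S : Set (PBond P j)) (δ : ℝ) :
    Invariant (prodAct (jrot (P := P) (j := j) (G := G)) (adAct Ad (ι := PBond P j)))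
      (charFn fun p : GaugeField P j G × VecField P j V => SupSmallOn S nV δ p.2) :=
  invariant_charFn fun g p => supSmallOn_adAct_iff hn δ g p.2

end Gauge

end Lattice

/-! ## §3  Measure: the product Lebesgue measure on the fluctuation fields is invariant under the adjoint action -/

section MeasureLevel

variable {G : Type*} {ι : Type*} {V : Type*} [NormedAddCommGroup V] [InnerProductSpace ℝ V]
  [MeasurableSpace V] [BorelSpace V]

/-- `adFamily f` is measurable. [folklore] -/
theorem measurable_adFamily (f : ι → V ≃ₗᵢ[ℝ] V) : Measurable (adFamily f) :=
  measurable_pi_lambda _ fun i => (f i).continuous.measurable.comp (measurable_pi_apply i)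

/-- `adFamily f` as a measurable automorphism of the field space (inverse: the inverse isometries). [folklore] -/
def adFamilyMEquiv (f : ι → V ≃ₗᵢ[ℝ] V) : (ι → V) ≃ᵐ (ι → V) where
  toFun := adFamily f
  invFun := adFamily fun i => (f i).symm
  left_inv := adFamily_symm_adFamily f
  right_inv := adFamily_adFamily_symm f
  measurable_toFun := measurable_adFamily f
  measurable_invFun := measurable_adFamily fun i => (f i).symm

/-- The underlying map of `adFamilyMEquiv`. [folklore] -/
@[simp] theorem coe_adFamilyMEquiv (f : ι → V ≃ₗᵢ[ℝ] V) : ⇑(adFamilyMEquiv f) = adFamily f := rfl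

variable [Fintype ι] [FiniteDimensional ℝ V]

/-- THE PRODUCT LEBESGUE MEASURE dA = Π_i dA(i) on `V`-valued fields IS INVARIANT under every coordinatewise family
of linear isometries (each factor is preserved: `LinearIsometryEquiv.measurePreserving`) — the site-dependent
adjoint gauge transformations (1.17) included. [folklore] -/
theorem pi_volume_map_adFamily (f : ι → V ≃ₗᵢ[ℝ] V) :
    (Measure.pi fun _ : ι => (volume : Measure V)).map (adFamily f) = Measure.pi fun _ : ι => volume := by
  have hσ : ∀ i : ι, SigmaFinite ((volume : Measure V).map (f i)) := fun i => by
    rw [(f i).measurePreserving.map_eq]; infer_instance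
  calc (Measure.pi fun _ : ι => (volume : Measure V)).map (adFamily f)
      = Measure.pi fun i : ι => (volume : Measure V).map (f i) :=
        Measure.pi_map_pi (μ := fun _ : ι => (volume : Measure V)) (f := fun i v => f i v)
          fun i => (f i).continuous.measurable.aemeasurable
    _ = Measure.pi fun _ : ι => (volume : Measure V) := by
        congr 1; funext i; exact (f i).measurePreserving.map_eq

/-- … in particular under the constant adjoint action. [folklore] -/
theorem pi_volume_map_adAct (Ad : G → V ≃ₗᵢ[ℝ] V) (g : G) :
    (Measure.pi fun _ : ι => (volume : Measure V)).map (adAct Ad g) = Measure.pi fun _ : ι => volume :=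
  pi_volume_map_adFamily fun _ => Ad g

/-- … and with any INVARIANT DENSITY (Gaussian measures dμ_C with a jointly invariant quadratic form at a fixed
rotation-fixed background, cut-off densities): `T4FlatExteriorInvariance.map_withDensity_eq_of_invariant`.
[folklore] -/
theorem pi_volume_withDensity_map_adFamily (f : ι → V ≃ₗᵢ[ℝ] V) (d : (ι → V) → ℝ≥0∞)
    (hd : ∀ A, d (adFamily f A) = d A) :
    ((Measure.pi fun _ : ι => (volume : Measure V)).withDensity d).map (adFamily f)
      = (Measure.pi fun _ : ι => (volume : Measure V)).withDensity d :=
  map_withDensity_eq_of_invariant _ (adFamilyMEquiv f) (pi_volume_map_adFamily f) d (funext hd)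

/-- THE FIBRE-NODE CLAUSE (`T4NestedCovariance.InvariantFibre`) for the Lebesgue measure on the fluctuation
variables under the constant adjoint action. [folklore] -/
theorem invariantFibre_adAct (Ad : G → V ≃ₗᵢ[ℝ] V) :
    InvariantFibre (adAct Ad (ι := ι)) (Measure.pi fun _ : ι => (volume : Measure V)) :=
  fun g => ⟨(adFamilyMEquiv fun _ : ι => Ad g).measurableEmbedding, pi_volume_map_adAct Ad g⟩

/-- … and for the Lebesgue measure with an Ad-invariant density. [folklore] -/
theorem invariantFibre_adAct_withDensity (Ad : G → V ≃ₗᵢ[ℝ] V) (d : (ι → V) → ℝ≥0∞)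
    (hd : ∀ (g : G) (A : ι → V), d (adAct Ad g A) = d A) :
    InvariantFibre (adAct Ad (ι := ι)) ((Measure.pi fun _ : ι => (volume : Measure V)).withDensity d) :=
  fun g => ⟨(adFamilyMEquiv fun _ : ι => Ad g).measurableEmbedding,
    pi_volume_withDensity_map_adFamily (fun _ => Ad g) d (hd g)⟩

variable {P : Params} {j : ℕ} [GaugeGroup G]

/-- HAND-OFF TO `T4FlatExteriorInvariance`: a JOINTLY invariant weight `w (U, A)` integrates over the fluctuation
field (Lebesgue, any finite index type) to a `ConjInvariant` function of the background — the hypothesis `hold` of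
`fibreLaw_map_conjFun` / `condLaw_map_conjFun` for the A-integrated factors (log Z^{(0)}(Λ₁)(U₁) and the
(1.26)/(2.21) A-integrals as functions of U).  No integrability hypothesis. [folklore] -/
theorem conjInvariant_marginal (Ad : G → V ≃ₗᵢ[ℝ] V) {W : Type*} [NormedAddCommGroup W] [NormedSpace ℝ W]
    {w : GaugeField P j G × (ι → V) → W}
    (hw : Invariant (prodAct (jrot (P := P) (j := j) (G := G)) (adAct Ad (ι := ι))) w) :
    ConjInvariant fun U : GaugeField P j G => ∫ A, w (U, A) ∂(Measure.pi fun _ : ι => (volume : Measure V)) :=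
  invariant_marginal (invariantFibre_adAct Ad) hw

/-- … also against the Lebesgue measure with an Ad-invariant density (a fixed invariant Gaussian reference measure).
[folklore] -/
theorem conjInvariant_marginal_withDensity (Ad : G → V ≃ₗᵢ[ℝ] V) (d : (ι → V) → ℝ≥0∞)
    (hd : ∀ (g : G) (A : ι → V), d (adAct Ad g A) = d A) {W : Type*} [NormedAddCommGroup W] [NormedSpace ℝ W]
    {w : GaugeField P j G × (ι → V) → W}
    (hw : Invariant (prodAct (jrot (P := P) (j := j) (G := G)) (adAct Ad (ι := ι))) w) :
    ConjInvariant fun U : GaugeField P j G =>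
      ∫ A, w (U, A) ∂((Measure.pi fun _ : ι => (volume : Measure V)).withDensity d) :=
  invariant_marginal (invariantFibre_adAct_withDensity Ad d hd) hw

end MeasureLevel

/-! ## §4  Forms: the joint one-scale configuration (U, A) and the two fibre nodes of (2.21) -/

section JointForms

universe u

variable {P : Params} {j : ℕ} {G : Type u} {V : Type u} [NormedAddCommGroup V] [InnerProductSpace ℝ V]

/-- THE JOINT ONE-SCALE CONFIGURATION (U, A): «the gauge field variables V_j» and «the fluctuation field variables
A_j» of (2.21), on one lattice. [cite: Balaban1988Convergent, (2.21) p.258] -/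
abbrev JCfg (P : Params) (j : ℕ) (G : Type u) (V : Type u) : Type u := GaugeField P j G × VecField P j V

variable [DecidableEq (PBond P j)]

/-- INSERTION of fluctuation variables on the bond set `s` into the A-component. [folklore] -/
def insA (s : Finset (PBond P j)) (a : ↥s → V) (p : JCfg P j G V) : JCfg P j G V := (p.1, updateFinset p.2 s a)

/-- INSERTION of bond variables on `s` into the U-component (the sibling leaves' `updateFinset` insertion, lifted).
[folklore] -/
def insV (s : Finset (PBond P j)) (y : ↥s → G) (p : JCfg P j G V) : JCfg P j G V := (updateFinset p.1 s y, p.2)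

/-- The adjoint action passes through `updateFinset` (rotated values into the rotated field). [folklore] -/
theorem adAct_updateFinset (Ad : G → V ≃ₗᵢ[ℝ] V) (s : Finset (PBond P j)) (g : G) (A : VecField P j V)
    (a : ↥s → V) : adAct Ad g (updateFinset A s a) = updateFinset (adAct Ad g A) s (adAct Ad g a) := by
  funext b
  by_cases hb : b ∈ s
  · simp only [updateFinset, adAct_apply, dif_pos hb]
  · simp only [updateFinset, adAct_apply, dif_neg hb]

variable [GaugeGroup G]

/-- THE JOINT ROTATION of (U, A): constant conjugation of the bond variables and the constant adjoint action on the
fluctuation field — (1.17) for u ≡ g (reading (R1)). [folklore] -/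
abbrev jointRot (Ad : G → V ≃ₗᵢ[ℝ] V) : G → JCfg P j G V → JCfg P j G V :=
  prodAct (jrot (P := P) (j := j) (G := G)) (adAct Ad (ι := PBond P j))

/-- `insA` is an `EquivariantInsertion` for the joint rotation (fibre action: the adjoint action on `↥s → V`).
[folklore] -/
theorem equivariantInsertion_insA (Ad : G → V ≃ₗᵢ[ℝ] V) (s : Finset (PBond P j)) :
    EquivariantInsertion (jointRot (P := P) (j := j) Ad) (adAct Ad (ι := ↥s)) (insA s) := fun g a p => by
  show (conjFun g p.1, adAct Ad g (updateFinset p.2 s a)) = (conjFun g p.1, updateFinset (adAct Ad g p.2) s _)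
  rw [adAct_updateFinset]

/-- `insV` is an `EquivariantInsertion` for the joint rotation (fibre action: conjugation on `↥s → G`). [folklore] -/
theorem equivariantInsertion_insV (Ad : G → V ≃ₗᵢ[ℝ] V) (s : Finset (PBond P j)) :
    EquivariantInsertion (jointRot (P := P) (j := j) Ad) (fun g => conjFun (ι := ↥s) g) (insV s) := fun g y p => by
  show (conjFun g (updateFinset p.1 s y), adAct Ad g p.2) = (updateFinset (conjFun g p.1) s _, adAct Ad g p.2)
  rw [updateFinset_jrot]

section ASide

variable [FiniteDimensional ℝ V] [MeasurableSpace V] [BorelSpace V]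

/-- THE A-FIBRE NODE ∫dA_j|_{s} of «∫dA_j|_{Z_{j+1}∩Ω_{j+1}∩X}» (2.21): Lebesgue integration over the fluctuation
variables on `s`, as a `Form` on the joint configuration type. [cite: Balaban1988Convergent, (2.21) p.258] -/
noncomputable def fibreNodeA (s : Finset (PBond P j)) : Form (JCfg P j G V) ℝ :=
  Form.fibre (↥s → V) inferInstance (Measure.pi fun _ : ↥s => (volume : Measure V)) (insA s)

/-- THE A-FIBRE NODE IS ADAPTED to the joint rotation (Lebesgue invariant under the adjoint action, insertion
equivariant). [folklore] -/
theorem adapted_fibreNodeA (Ad : G → V ≃ₗᵢ[ℝ] V) (s : Finset (PBond P j)) :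
    (fibreNodeA s : Form (JCfg P j G V) ℝ).Adapted (jointRot (P := P) (j := j) Ad) :=
  ⟨adAct Ad (ι := ↥s), invariantFibre_adAct (ι := ↥s) Ad, equivariantInsertion_insA Ad s⟩

/-- THE (2.21)-SHAPED FLUCTUATION INTEGRATION `F ↦ ((U,A) ↦ ∫ w(U, A←a) F(U, A←a) da)` with weight `w` (cut-off
times Gaussian weight) as a form: the A-fibre node after the weight node. [cite: Balaban1988Convergent, (2.21) p.258] -/
noncomputable def fluctForm (s : Finset (PBond P j)) (w : JCfg P j G V → ℝ) : Form (JCfg P j G V) ℝ :=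
  Form.comp (fibreNodeA s) (Form.mul w)

/-- It is ADAPTED as soon as the weight is jointly invariant (`invariant_gaussWeight`, `invariant_oneStepWeight`,
`invariant_charFn_supSmallOn`, `invariant_charFn_mixedSmallOn`, products by `Invariant.mul`). [folklore] -/
theorem adapted_fluctForm (Ad : G → V ≃ₗᵢ[ℝ] V) (s : Finset (PBond P j)) {w : JCfg P j G V → ℝ}
    (hw : Invariant (jointRot (P := P) (j := j) Ad) w) : (fluctForm s w).Adapted (jointRot (P := P) (j := j) Ad) :=
  ⟨adapted_fibreNodeA Ad s, hw⟩

/-- … hence a COVARIANT operation on integrands with values in any real normed space (`Form.covariant_eval`), ready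
to be nested with the V-fibre operations of `T4NestedCovarianceFibre`. [folklore] -/
theorem covariant_fluctForm (Ad : G → V ≃ₗᵢ[ℝ] V) (s : Finset (PBond P j)) {w : JCfg P j G V → ℝ}
    (hw : Invariant (jointRot (P := P) (j := j) Ad) w) {E : Type*} [NormedAddCommGroup E] [NormedSpace ℝ E] :
    Covariant (jointRot (P := P) (j := j) Ad) ((fluctForm s w).eval : Op (JCfg P j G V) E) :=
  Form.covariant_eval _ (adapted_fluctForm Ad s hw)

/-- Jointly invariant scalar weights stay jointly invariant through the fluctuation integration (normalisers such as
Z^{(0)}(Λ₁) as functions of (U₁, Λ₁ᶜA)). [folklore] -/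
theorem invariant_fluctForm_eval (Ad : G → V ≃ₗᵢ[ℝ] V) (s : Finset (PBond P j)) {w χ : JCfg P j G V → ℝ}
    (hw : Invariant (jointRot (P := P) (j := j) Ad) w) (hχ : Invariant (jointRot (P := P) (j := j) Ad) χ) :
    Invariant (jointRot (P := P) (j := j) Ad) ((fluctForm s w).eval (E := ℝ) χ) :=
  Form.invariant_eval _ (adapted_fluctForm Ad s hw) hχ

end ASide

section VSide

variable [MeasurableSpace G] [HaarData G]

/-- THE V-FIBRE NODE ∫dV_j|_{s} of «∫dV_j|_{Ω^c_{j+1}∩X}» (2.21) (product Haar) on the joint configuration type.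
[cite: Balaban1988Convergent, (2.21) p.258] -/
noncomputable def fibreNodeV (s : Finset (PBond P j)) : Form (JCfg P j G V) ℝ :=
  Form.fibre (↥s → G) inferInstance (Measure.pi fun _ : ↥s => (HaarData.haar : Measure G)) (insV s)

variable [MeasurableMul G]

/-- THE V-FIBRE NODE IS ADAPTED to the joint rotation (`invariantFibre_piHaar` of the sibling leaf). [folklore] -/
theorem adapted_fibreNodeV (Ad : G → V ≃ₗᵢ[ℝ] V) (s : Finset (PBond P j)) :
    (fibreNodeV s : Form (JCfg P j G V) ℝ).Adapted (jointRot (P := P) (j := j) Ad) :=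
  ⟨fun g => conjFun (ι := ↥s) g, invariantFibre_piHaar (G := G) (↥s), equivariantInsertion_insV Ad s⟩

end VSide

section Both

variable [FiniteDimensional ℝ V] [MeasurableSpace V] [BorelSpace V] [MeasurableSpace G] [HaarData G]
  [MeasurableMul G]

/-- THE PRINTED PRODUCT ∫dV_j|_{…}(weight) · ∫dA_j|_{…}(weight) of (2.21) as one form on (U, A): adapted, hence
covariant, whenever both weights are jointly invariant. [folklore] -/
theorem adapted_oneStepForm (Ad : G → V ≃ₗᵢ[ℝ] V) (sV sA : Finset (PBond P j)) {wV wA : JCfg P j G V → ℝ}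
    (hwV : Invariant (jointRot (P := P) (j := j) Ad) wV) (hwA : Invariant (jointRot (P := P) (j := j) Ad) wA) :
    (Form.comp (Form.comp (fibreNodeV sV) (Form.mul wV)) (fluctForm sA wA)).Adapted
      (jointRot (P := P) (j := j) Ad) :=
  ⟨⟨adapted_fibreNodeV Ad sV, hwV⟩, adapted_fluctForm Ad sA hwA⟩

/-- … hence COVARIANT on integrands with values in any real normed space. [folklore] -/
theorem covariant_oneStepForm (Ad : G → V ≃ₗᵢ[ℝ] V) (sV sA : Finset (PBond P j)) {wV wA : JCfg P j G V → ℝ}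
    (hwV : Invariant (jointRot (P := P) (j := j) Ad) wV) (hwA : Invariant (jointRot (P := P) (j := j) Ad) wA)
    {E : Type*} [NormedAddCommGroup E] [NormedSpace ℝ E] :
    Covariant (jointRot (P := P) (j := j) Ad)
      ((Form.comp (Form.comp (fibreNodeV sV) (Form.mul wV)) (fluctForm sA wA)).eval : Op (JCfg P j G V) E) :=
  Form.covariant_eval _ (adapted_oneStepForm Ad sV sA hwV hwA)

end Both

end JointForms

end Literature.MathematicalPhysics.QuantumFieldTheory.Balaban1983to89.T4AdjointCovariance
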